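import Summits.BirchSwinnertonDyer.BirchSwinnertonDyer.Theorems.ManinLocalTwoThreeManinPrimeToThreeAtNineOfOrdJLeZero
import Literature.NumberTheory.EllipticCurves.RootNumberTwistSemistableProofs
import HarnessLib

/-!
# C3 `ManinPrimeToThreeAtNine` HOLDS whenever a ternary twist `W ⊗ ℚ(√±3)` is SEMISTABLE at `3` — the E-blind `f₃(W ⊗ d) ≤ 1` form, modulo
# Mazur 1978 and modularity only (route `ManinLocalTwoThree`, crux C3 stmt-BirchSwinnertonDyer-22968; cell bsd-f2-manin, p2 gen 15)

The `p = 3` twin of this seat's g14 `not_two_dvd_maninConstant_of_conductorExponent_quadraticTwist_le_one` (C2): for a lattice-optimal `X₀(N)`-datum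
of a globally minimal `W` with `9 ∣ N`, if `f₃(W ⊗ d) ≤ 1` for `d = −3` or `d = 3`, then `3 ∤ c`.  One line over the tree's `Γ₀` certificate
`not_dvd_maninConstant_of_isSemistableAt_quadraticTwist_pStar_of_mazur` (Stevens 1989 (5.2) on `Γ₀` + Mazur 1978 Cor. 4.1 at the twisted class):
`f ≤ 1` means good or multiplicative (`two_le_conductorExponent_iff_holds` + trichotomy), and `W ⊗ 3 = (W ⊗ (−3)) ⊗ (−1)` has the reduction type of
`W ⊗ (−3)` at `3` (`−1` is a `3`-adic unit: `hasReductionAt_quadraticTwist_iff_of_not_dvd`).  Only `hM` and `hnf` of the crux's four binders are used.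
HONEST FRAMING: by-name partial discharge on the twist-covered locus (class-level already the landed `…TwistCovered` / p2 g2 reductions; here E-blind);
nothing about BSD is proved; Manin's conjecture at `3` / C3 OPEN on the core.
[cite: Stevens1989, Lemmas (5.2), (5.4)] [cite: Mazur1978, Cor. 4.1] [cite: SilvermanAEC2009, VII.5 Prop. 5.1 and X.5 Cor. 5.4]
-/

set_option autoImplicit false
-- lint-debt: the directory name repeats the summit name (sibling precedent `ManinLocalTwoThreeManinPrimeToThreeAtNineOfOrdJLeZero.lean`)
set_option linter.dupNamespace false

noncomputable section

open scoped Classical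
open WeierstrassCurve IsDedekindDomain IsDedekindDomain.HeightOneSpectrum Rat.HeightOneSpectrum
  Literature.NumberTheory.DiophantineGeometry Literature.NumberTheory.EllipticCurves
  Literature.NumberTheory.EllipticCurves.ModularForms

namespace Summit.BirchSwinnertonDyer.BirchSwinnertonDyer.Theorems.ManinLocalTwoThree

/-- **`f₃(W ⊗ (−3)) ≤ 1` ⟹ `3 ∤ c`** for every lattice-optimal `X₀(N)`-datum of the globally minimal `W` with `9 ∣ N`, modulo Mazur + modularity.
[cite: Stevens1989, Lemmas (5.2), (5.4)] [cite: Mazur1978, Cor. 4.1] -/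
theorem not_three_dvd_maninConstant_of_conductorExponent_quadraticTwist_negThree_le_one_of_mazur
    (hM : mazur_not_dvd_maninConstant_of_odd) (hnf : exists_isNewformOf)
    {W : WeierstrassCurve ℚ} [W.IsElliptic] [W.IsGloballyMinimal] {N : ℕ} [NeZero N] (D : ModularParametrizationData W N)
    (hopt : ∀ z ∈ D.L.lattice, ∃ w ∈ periodLattice D.f, z = D.c * w) (h9 : 3 ^ 2 ∣ N)
    (hf : (haveI := W.isElliptic_quadraticTwist (show ((-3 : ℤ) : ℚ) ≠ 0 by norm_num);
      (W.quadraticTwist ((-3 : ℤ) : ℚ)).conductorExponent ((primesEquiv (R := ℤ)).symm ⟨3, Nat.prime_three⟩)) ≤ 1) :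
    ¬ (3 : ℤ) ∣ D.maninConstant := by
  haveI := W.isElliptic_quadraticTwist (show ((-3 : ℤ) : ℚ) ≠ 0 by norm_num)
  set v : HeightOneSpectrum ℤ := (primesEquiv (R := ℤ)).symm ⟨3, Nat.prime_three⟩ with hvdef
  haveI : PerfectField (IsLocalRing.ResidueField (v.adicCompletionIntegers ℚ)) := PerfectField.ofFinite
  have hsemi : (W.quadraticTwist ((-3 : ℤ) : ℚ)).HasGoodReductionAt v ∨ (W.quadraticTwist ((-3 : ℤ) : ℚ)).HasMultiplicativeReductionAt v := by
    rcases hasGoodReductionAt_or_hasMultiplicativeReductionAt_or_hasAdditiveReductionAt v (W.quadraticTwist ((-3 : ℤ) : ℚ)) with hg | hm | ha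
    · exact Or.inl hg
    · exact Or.inr hm
    · exact absurd ((two_le_conductorExponent_iff_holds v _).mpr ha) (by omega)
  refine not_dvd_maninConstant_of_isSemistableAt_quadraticTwist_pStar_of_mazur hM hnf D hopt Nat.prime_three (by decide) h9 ?_
  convert hsemi using 3 <;> norm_num

/-- **`f₃(W ⊗ 3) ≤ 1` ⟹ `3 ∤ c`** likewise: `W ⊗ 3 = (W ⊗ (−3)) ⊗ (−1)` has the reduction type of `W ⊗ (−3)` at `3` (`3 ∤ −1`).
[cite: Stevens1989, Lemmas (5.2), (5.4)] [cite: Mazur1978, Cor. 4.1] [cite: SilvermanAEC2009, VII.5 Prop. 5.1] -/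
theorem not_three_dvd_maninConstant_of_conductorExponent_quadraticTwist_three_le_one_of_mazur
    (hM : mazur_not_dvd_maninConstant_of_odd) (hnf : exists_isNewformOf)
    {W : WeierstrassCurve ℚ} [W.IsElliptic] [W.IsGloballyMinimal] {N : ℕ} [NeZero N] (D : ModularParametrizationData W N)
    (hopt : ∀ z ∈ D.L.lattice, ∃ w ∈ periodLattice D.f, z = D.c * w) (h9 : 3 ^ 2 ∣ N)
    (hf : (haveI := W.isElliptic_quadraticTwist (show ((3 : ℤ) : ℚ) ≠ 0 by norm_num);
      (W.quadraticTwist ((3 : ℤ) : ℚ)).conductorExponent ((primesEquiv (R := ℤ)).symm ⟨3, Nat.prime_three⟩)) ≤ 1) :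
    ¬ (3 : ℤ) ∣ D.maninConstant := by
  haveI := W.isElliptic_quadraticTwist (show ((3 : ℤ) : ℚ) ≠ 0 by norm_num)
  haveI := W.isElliptic_quadraticTwist (show ((-3 : ℤ) : ℚ) ≠ 0 by norm_num)
  haveI := (W.quadraticTwist ((-3 : ℤ) : ℚ)).isElliptic_quadraticTwist (show ((-1 : ℤ) : ℚ) ≠ 0 by norm_num)
  have hv : natGenerator ((primesEquiv (R := ℤ)).symm ⟨3, Nat.prime_three⟩) = 3 :=
    congrArg Subtype.val ((primesEquiv (R := ℤ)).apply_symm_apply ⟨3, Nat.prime_three⟩)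
  haveI : PerfectField (IsLocalRing.ResidueField (((primesEquiv (R := ℤ)).symm ⟨3, Nat.prime_three⟩).adicCompletionIntegers ℚ)) :=
    PerfectField.ofFinite
  -- `W ⊗ 3 = (W ⊗ (−3)) ⊗ (−1)` on the nose
  have h33 : (W.quadraticTwist ((-3 : ℤ) : ℚ)).quadraticTwist ((-1 : ℤ) : ℚ) = W.quadraticTwist ((3 : ℤ) : ℚ) := by
    rw [quadraticTwist_quadraticTwist]; norm_num
  have hna3 : ¬ (W.quadraticTwist ((3 : ℤ) : ℚ)).HasAdditiveReductionAt ((primesEquiv (R := ℤ)).symm ⟨3, Nat.prime_three⟩) := fun ha ↦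
    absurd ((two_le_conductorExponent_iff_holds _ _).mpr ha) (by omega)
  have hna : ¬ (W.quadraticTwist ((-3 : ℤ) : ℚ)).HasAdditiveReductionAt ((primesEquiv (R := ℤ)).symm ⟨3, Nat.prime_three⟩) := fun ha ↦ by
    have key := ((W.quadraticTwist ((-3 : ℤ) : ℚ)).hasReductionAt_quadraticTwist_iff_of_not_dvd
      ((primesEquiv (R := ℤ)).symm ⟨3, Nat.prime_three⟩) (by rw [hv]; decide) (d := -1) (by rw [hv]; decide)).2.2
    rw [h33] at key
    exact hna3 (key.mpr ha)
  refine not_three_dvd_maninConstant_of_conductorExponent_quadraticTwist_negThree_le_one_of_mazur hM hnf D hopt h9 ?_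
  by_contra hlt
  exact hna ((two_le_conductorExponent_iff_holds _ _).mp (by omega))

/-- **Crux-shape corollary**: for `d = −3` or `d = 3`, `f₃(W ⊗ d) ≤ 1` ⟹ `3 ∤ c`, with all four printed-fact binders offered (only Mazur and
modularity used) — the by-name complement of `maninPrimeToThreeAtNine_of_core`'s twist binder.
[cite: Stevens1989, Lemmas (5.2), (5.4)] [cite: Mazur1978, Cor. 4.1] -/
theorem not_three_dvd_maninConstant_of_conductorExponent_ternaryTwist_le_one
    (hM : mazur_not_dvd_maninConstant_of_odd) (hnf : exists_isNewformOf)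
    {W : WeierstrassCurve ℚ} [W.IsElliptic] [W.IsGloballyMinimal] {N : ℕ} [NeZero N] (D : ModularParametrizationData W N)
    (hopt : ∀ z ∈ D.L.lattice, ∃ w ∈ periodLattice D.f, z = D.c * w) (h9 : 3 ^ 2 ∣ N)
    {d : ℤ} (hd : d = -3 ∨ d = 3)
    (hf : (haveI := W.isElliptic_quadraticTwist (show (d : ℚ) ≠ 0 by exact_mod_cast (show d ≠ 0 by omega));
      (W.quadraticTwist (d : ℚ)).conductorExponent ((primesEquiv (R := ℤ)).symm ⟨3, Nat.prime_three⟩)) ≤ 1) :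
    ¬ (3 : ℤ) ∣ D.maninConstant := by
  rcases hd with rfl | rfl
  · exact not_three_dvd_maninConstant_of_conductorExponent_quadraticTwist_negThree_le_one_of_mazur hM hnf D hopt h9 hf
  · exact not_three_dvd_maninConstant_of_conductorExponent_quadraticTwist_three_le_one_of_mazur hM hnf D hopt h9 hf

end Summit.BirchSwinnertonDyer.BirchSwinnertonDyer.Theorems.ManinLocalTwoThree

end
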